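import Literature.IUT.LogThetaLattice.PacketLogVolumesProofs
import Literature.IUT.LogVolume.PrincipalArithmeticDivisors
import HarnessLib

/-!
# [IUTchIII] Proposition 3.9 (iii) — the INVARIANCE clause ("product formula") and "global log-volume
# = degree" in the arithmetic-divisor model WITH archimedean places (abc-iut cell, layer L6 ↔ campaign S)

S. Mochizuki, *Inter-universal Teichmüller theory III*, kurims manuscript (May 2020), §3, Proposition
3.9 (iii) "(Global Compatibility)", p. 117 [claim: Mochizuki2012, status: disputed]: "by adding the
log-volumes of (i) [all but finitely many of which are zero!] at the various `v_ℚ ∈ 𝕍_ℚ`, one obtains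
a global log-volume `μ^log_{A,𝕍_ℚ} : 𝕄(𝓘^ℚ(^A𝓕_{𝕍_ℚ})) → ℝ` which is invariant with respect to
multiplication by elements of `(†𝕄⊛_mod)_α = (†𝕄⊛_MOD)_α ⊆ 𝓘^ℚ(^A𝓕_{𝕍_ℚ})` … the global log-volume
`μ^log_{A,𝕍_ℚ}(𝔍)` is equal to the degree of the arithmetic line bundle determined by `𝔍` [cf. the
natural isomorphism `(†𝓕⊛_mod)_α ⥲ (†𝓕⊛_𝔪𝔬𝔡)_α` of Proposition 3.7, (ii); Remark 3.6.1, (i)], relative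
to a suitable normalization."

The statement file `PacketLogVolumes.lean` (abc-iut-L6-t4, p404053) types this as the REAL data
`GlobalRegion μlog`, `globalLogVolume μlog` over an abstract family of local log-volumes
`μlog : ∀ v, Region v → ℝ`, plus two `Prop`-valued predicates `Prop39iii_invariance μlog act`
(invariance under an abstract action `act`) and `Prop39iii_degree μlog regionOf deg`. The companion
`PacketLogVolumesProofs.lean` (abc-iut-L6-t5, p405284) reduces invariance to an additive product
formula (`Prop39iii_invariance_of_productFormula`), and `PacketLogVolumesDegreeBridge.lean`
(abc-iut-L6-d3, p406968) proved the DEGREE clause in the Dupuy–Hilado packet model, recording that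
the INVARIANCE clause "needs the archimedean factor + product formula, absent from `PacketModel F`".

## This file: the arithmetic-divisor ("log-radius") model, which HAS the archimedean places

For a number field `F` we instantiate the statement file's data by the `ℝ`-arithmetic divisors of
campaign S (`RArithmeticDivisors.lean`, [IUTchIV] Def. 1.9 (i): `Place F = 𝕍(F)^arc ⊕ 𝕍(F)^non`,
`ADivisor F = Place F →₀ ℝ`, `degF` with weights `deg_F(v) = 1` resp. `log q_v`):

* index set `VQ := Place F` = `𝕍(F)` (one region per place of `F`; the `𝕍_ℚ`-packeted presentation of
  the print, which groups the places `v | v_ℚ`, has the same global sum — it is treated in the sequel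
  file `PacketLogVolumesPrincipalPackets.lean`);
* `Region v := ℝ`, a region at `v` being recorded by its DIVISOR COORDINATE `c_v`: at `v ∈ 𝕍(F)^non` the
  fractional ideal `𝔭_v^{-c_v}·𝒪_v ⊆ F_v` (`c_v ∈ ℤ`; normalised log-volume `c_v·log q_v`, cf.
  `Literature.IUT.LogVolume.localLogVolume_closedBall_zpow`), at `v ∈ 𝕍(F)^arc` the disc obtained from
  the unit disc by the homothety of ratio `exp(c_v/[F_v:ℝ])` (log-volume `c_v` relative to the unit
  disc);
* `μlog v c := c · deg_F(v)` (`divisorLogVolume`); then `GlobalRegion μlog` — "components with zero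
  log-volume for all but finitely many `v`" — is EXACTLY `ADiv_ℝ(F)` (`globalRegionEquivADivisor`) and
  `globalLogVolume μlog = deg_F` (`globalLogVolume_eq_degF`);
* the action of `f ∈ F^×` ("multiplication by elements of `(†𝕄⊛_mod)_α`", i.e. by nonzero elements of
  the number field) is translation by `−ADiv(f)` (`principalAction`): `f·𝔭_v^{-c} 𝒪_v =
  𝔭_v^{-(c - ord_v f)} 𝒪_v` and `|f|_v·exp(c/[F_v:ℝ]) = exp((c + [F_v:ℝ] log|f|_v)/[F_v:ℝ])`, with
  `ADiv(f)_v = ord_v(f)` resp. `−[F_v:ℝ]·log|f|_v` (`PrincipalArithmeticDivisors.lean`, abc-iut-L6-t16,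
  p407726, [GenEll] §1).

RESULTS (all sorry-free; nothing here edits the files of t4/t5/t16/S2):
* **`prop39iii_invariance_divisorModel`** — **IUTchIII:Prop3.9(iii)** invariance clause
  `Prop39iii_invariance (divisorLogVolume F) (principalAction F)` HOLDS, obtained by feeding the TREE's
  product formula `degF_principal : deg_F(ADiv(f)) = 0` (log form of Mathlib's
  `NumberField.prod_abs_eq_one`) into abc-iut-L6-t5's reduction `Prop39iii_invariance_of_productFormula`
  with local terms `c_f(v) = −ADiv(f)_v · deg_F(v)`;
* **`prop39iii_degree_divisorModel`** — the degree clause `Prop39iii_degree` with normalization `c = 1`,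
  objects `𝔍 :=` arithmetic divisors and `deg := deg_F` (companion of the DH-side `prop39iii_degree_dh`);
* `globalLogVolume_eq_degFQuot` — the global log-volume only depends on the class in
  `ADiv_ℝ(F)/APrc(F)` ("the degree of the arithmetic LINE BUNDLE determined by `𝔍`": line bundles =
  divisor classes modulo principal divisors, [GenEll] §1 `ADiv(F)/APrc(F) ⥲ APic(Spec 𝒪_F)`);
* `principalAction_one/_mul` — it is an action of `F^×`.

HONEST FRAMING: this discharges the typed predicate in ONE concrete model of the statement file's
abstract data — the classical idelic / arithmetic-divisor content of the printed sentence (the product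
formula for number fields). It constructs no Frobenioid `(†𝓕⊛_mod)_α`, no tensor packet and no
log-shell, asserts nothing about [IUTchIII] Cor. 3.12, and takes no side; typed ≠ discharged elsewhere.
[claim: Mochizuki2012, status: disputed] for the IUT sentences quoted; the mathematics proved is
[GenEll] §1 / [IUTchIV] Def. 1.9 (i) (product formula), cite keys `MochizukiGenEll2010`, `Mochizuki2012`.
-/

namespace Literature.IUT.LogThetaLattice

open Literature.IUT.LogVolume NumberField IsDedekindDomain Finset

universe u

variable (F : Type u) [Field F] [NumberField F]

/-! ### The local log-volume datum in divisor coordinates -/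

/-- **IUTchIII:Prop3.9(iii)** (kurims p.117) datum `μlog : ∀ v, Region v → ℝ` of the statement file in the
arithmetic-divisor model: at the place `v ∈ 𝕍(F)` the region with divisor coordinate `c` has
log-volume `c · deg_F(v)` (`deg_F(v) = log q_v` at a finite `v`, `= 1` at an archimedean `v`,
[IUTchIV] Def. 1.9 (i)). [claim: Mochizuki2012, status: disputed] -/
noncomputable def divisorLogVolume (v : Place F) (c : ℝ) : ℝ := c * degWeight F v

/-- Unfolding `μlog_v(c) = c · deg_F(v)`. [claim: Mochizuki2012, status: disputed] -/
@[simp] theorem divisorLogVolume_apply (v : Place F) (c : ℝ) :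
    divisorLogVolume F v c = c * degWeight F v := rfl

/-- `μlog_v(c) = 0 ↔ c = 0` (the weights `deg_F(v)` are positive). [claim: Mochizuki2012, status: disputed] -/
theorem divisorLogVolume_eq_zero_iff (v : Place F) (c : ℝ) : divisorLogVolume F v c = 0 ↔ c = 0 := by
  rw [divisorLogVolume_apply, mul_eq_zero, or_iff_left (degWeight_pos F v).ne']

/-- The places of nonzero log-volume of a family of coordinates are its support.
[claim: Mochizuki2012, status: disputed] -/
theorem support_divisorLogVolume (S : Place F → ℝ) :
    (Function.support fun v => divisorLogVolume F v (S v)) = Function.support S := by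
  ext v
  simp only [Function.mem_support, ne_eq, divisorLogVolume_eq_zero_iff]

/-! ### `𝕄(𝓘^ℚ(^A𝓕_{𝕍_ℚ}))` in this model is `ADiv_ℝ(F)`, and the global log-volume is `deg_F` -/

/-- **IUTchIII:Prop3.9(iii)** (kurims p.117) "the subset of elements whose components … have zero
log-volume for all but finitely many" places, in the arithmetic-divisor model, IS the `ℝ`-module of
`ℝ`-arithmetic divisors `ADiv_ℝ(F) = Place F →₀ ℝ` of [IUTchIV] Def. 1.9 (i): the statement file's
`GlobalRegion (divisorLogVolume F)` is in canonical bijection with `ADivisor F` (same underlying function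
`𝕍(F) → ℝ`). [claim: Mochizuki2012, status: disputed] -/
noncomputable def globalRegionEquivADivisor : GlobalRegion (divisorLogVolume F) ≃ ADivisor F where
  toFun S := Finsupp.ofSupportFinite S.1 (by rw [← support_divisorLogVolume F S.1]; exact S.2)
  invFun a := ⟨a, by rw [support_divisorLogVolume]; exact a.hasFiniteSupport⟩
  left_inv S := Subtype.ext (Finsupp.ofSupportFinite_coe)
  right_inv a := Finsupp.ext fun v => by simp only [Finsupp.ofSupportFinite_coe]

/-- Coordinates are unchanged: `(S ↦ 𝔞)(v) = S_v`. [claim: Mochizuki2012, status: disputed] -/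
@[simp] theorem globalRegionEquivADivisor_apply (S : GlobalRegion (divisorLogVolume F)) (v : Place F) :
    globalRegionEquivADivisor F S v = S.1 v := rfl

/-- Coordinates are unchanged: `(𝔞 ↦ S)_v = c_v`. [claim: Mochizuki2012, status: disputed] -/
@[simp] theorem globalRegionEquivADivisor_symm_apply (a : ADivisor F) (v : Place F) :
    ((globalRegionEquivADivisor F).symm a).1 v = a v := rfl

/-- **IUTchIII:Prop3.9(iii)** (kurims p.117): in the arithmetic-divisor model the global log-volume
"obtained by adding the log-volumes … at the various" places IS the degree map `deg_F` of [IUTchIV]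
Def. 1.9 (i): `μ^log(S) = deg_F(𝔞_S) = Σ_v c_v · deg_F(v)`. [claim: Mochizuki2012, status: disputed] -/
theorem globalLogVolume_eq_degF (S : GlobalRegion (divisorLogVolume F)) :
    globalLogVolume (divisorLogVolume F) S = degF F (globalRegionEquivADivisor F S) := by
  rw [degF_apply, Finsupp.sum, globalLogVolume]
  refine finsum_eq_sum_of_support_subset _ fun v hv => ?_
  rw [support_divisorLogVolume] at hv
  exact Finset.mem_coe.mpr (Finsupp.mem_support_iff.mpr (Function.mem_support.mp hv))

/-- The same, starting from a divisor: `μ^log(S_𝔞) = deg_F(𝔞)`. [claim: Mochizuki2012, status: disputed] -/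
theorem globalLogVolume_symm_eq_degF (a : ADivisor F) :
    globalLogVolume (divisorLogVolume F) ((globalRegionEquivADivisor F).symm a) = degF F a := by
  rw [globalLogVolume_eq_degF, Equiv.apply_symm_apply]

/-! ### Multiplication by `f ∈ F^×` = translation by `−ADiv(f)` -/

/-- **IUTchIII:Prop3.9(iii)** (kurims p.117) "multiplication by elements of `(†𝕄⊛_mod)_α`" (the nonzero
elements of the number field) on global regions, in the arithmetic-divisor model: `f` sends the region
with coordinates `(c_v)_v` to the one with coordinates `(c_v − ADiv(f)_v)_v`
(`f · 𝔭_v^{-c}𝒪_v = 𝔭_v^{-(c − ord_v f)}𝒪_v`; `|f|_v · e^{c/[F_v:ℝ]} = e^{(c + [F_v:ℝ]log|f|_v)/[F_v:ℝ]}`).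
[claim: Mochizuki2012, status: disputed] -/
noncomputable def principalAction (f : Fˣ) (S : GlobalRegion (divisorLogVolume F)) :
    GlobalRegion (divisorLogVolume F) :=
  (globalRegionEquivADivisor F).symm (globalRegionEquivADivisor F S - ADivisor.principal (f : F))

/-- Coordinates of `f·S`: `c_v − ADiv(f)_v`. [claim: Mochizuki2012, status: disputed] -/
@[simp] theorem principalAction_apply (f : Fˣ) (S : GlobalRegion (divisorLogVolume F)) (v : Place F) :
    (principalAction F f S).1 v = S.1 v - ADivisor.principal (f : F) v := by
  simp only [principalAction, globalRegionEquivADivisor_symm_apply, Finsupp.sub_apply,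
    globalRegionEquivADivisor_apply]

/-- As divisors: `𝔞_{f·S} = 𝔞_S − ADiv(f)`. [claim: Mochizuki2012, status: disputed] -/
theorem globalRegionEquivADivisor_principalAction (f : Fˣ) (S : GlobalRegion (divisorLogVolume F)) :
    globalRegionEquivADivisor F (principalAction F f S) =
      globalRegionEquivADivisor F S - ADivisor.principal (f : F) := by
  rw [principalAction, Equiv.apply_symm_apply]

/-- `1 ∈ F^×` acts trivially (`ADiv(1) = 0`). [claim: Mochizuki2012, status: disputed] -/
@[simp] theorem principalAction_one (S : GlobalRegion (divisorLogVolume F)) :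
    principalAction F 1 S = S := by
  apply (globalRegionEquivADivisor F).injective
  rw [globalRegionEquivADivisor_principalAction, Units.val_one, ADivisor.principal_one, sub_zero]

/-- `(fg)·S = f·(g·S)` (`ADiv(fg) = ADiv(f) + ADiv(g)`): `principalAction` is an action of `F^×`.
[claim: Mochizuki2012, status: disputed] -/
theorem principalAction_mul (f g : Fˣ) (S : GlobalRegion (divisorLogVolume F)) :
    principalAction F (f * g) S = principalAction F f (principalAction F g S) := by
  apply (globalRegionEquivADivisor F).injective
  rw [globalRegionEquivADivisor_principalAction, globalRegionEquivADivisor_principalAction,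
    globalRegionEquivADivisor_principalAction, Units.val_mul,
    ADivisor.principal_mul f.ne_zero g.ne_zero]
  abel

/-- The LOCAL change of log-volume under `f`: `μlog_v((f·S)_v) = μlog_v(S_v) + (−ADiv(f)_v · deg_F(v))`,
i.e. `+ log‖f‖_v` in the normalisation of [IUTchIV] Def. 1.9 — the additive local terms whose sum over
all places is the product formula. [claim: Mochizuki2012, status: disputed] -/
theorem divisorLogVolume_principalAction (f : Fˣ) (S : GlobalRegion (divisorLogVolume F)) (v : Place F) :
    divisorLogVolume F v ((principalAction F f S).1 v) =
      divisorLogVolume F v (S.1 v) + -(ADivisor.principal (f : F) v * degWeight F v) := by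
  rw [principalAction_apply, divisorLogVolume_apply, divisorLogVolume_apply]
  ring

/-- The local terms `ADiv(f)_v · deg_F(v)` are finitely supported. [claim: Mochizuki2012, status: disputed] -/
theorem finite_support_principal_mul_degWeight (f : F) :
    (Function.support fun v => -(ADivisor.principal f v * degWeight F v)).Finite := by
  refine Set.Finite.subset (ADivisor.principal f).hasFiniteSupport fun v hv => ?_
  rw [Function.mem_support, neg_ne_zero] at hv
  exact Function.mem_support.mpr (left_ne_zero_of_mul hv)

/-- **The product formula in the additive shape consumed by `Prop39iii_invariance_of_productFormula`**:
`Σ_v ADiv(f)_v · deg_F(v) = deg_F(ADiv(f)) = 0` (the tree's `degF_principal`, i.e. the logarithm of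
Mathlib's `NumberField.prod_abs_eq_one`). [claim: Mochizuki2012, status: disputed] -/
theorem finsum_principal_mul_degWeight (f : F) :
    ∑ᶠ v, ADivisor.principal f v * degWeight F v = 0 := by
  rw [← degF_principal F f, degF_apply, Finsupp.sum]
  refine finsum_eq_sum_of_support_subset _ fun v hv => ?_
  simpa only [Finset.mem_coe, Finsupp.mem_support_iff] using left_ne_zero_of_mul hv

/-! ### The two clauses of Proposition 3.9 (iii) in the arithmetic-divisor model -/

/-- **IUTchIII:Prop3.9(iii)** (kurims p.117) INVARIANCE CLAUSE DISCHARGED in the arithmetic-divisor model: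
the global log-volume "is invariant with respect to multiplication by elements of `(†𝕄⊛_mod)_α`" — the
statement file's `Prop39iii_invariance` HOLDS for `μlog := divisorLogVolume F` and the action of `F^×` by
`principalAction F`, via abc-iut-L6-t5's reduction `Prop39iii_invariance_of_productFormula` fed with the
product formula `degF_principal` (`finsum_principal_mul_degWeight`). [claim: Mochizuki2012, status: disputed] -/
theorem prop39iii_invariance_divisorModel :
    Prop39iii_invariance (divisorLogVolume F) (principalAction F) :=
  Prop39iii_invariance_of_productFormula (divisorLogVolume F) (principalAction F)
    (fun f v => -(ADivisor.principal (f : F) v * degWeight F v))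
    (fun f => finite_support_principal_mul_degWeight F (f : F))
    (fun f => by rw [finsum_neg_distrib, finsum_principal_mul_degWeight, neg_zero])
    (fun f S v => divisorLogVolume_principalAction F f S v)

/-- The invariance unfolded: `μ^log(f·S) = μ^log(S)` for every `f ∈ F^×` and every global region `S`.
[claim: Mochizuki2012, status: disputed] -/
theorem globalLogVolume_principalAction (f : Fˣ) (S : GlobalRegion (divisorLogVolume F)) :
    globalLogVolume (divisorLogVolume F) (principalAction F f S) =
      globalLogVolume (divisorLogVolume F) S :=
  prop39iii_invariance_divisorModel F f S

/-- The same identity read through `deg_F`: `deg_F(𝔞_S − ADiv(f)) = deg_F(𝔞_S)`.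
[claim: Mochizuki2012, status: disputed] -/
theorem degF_sub_principal_eq (f : Fˣ) (S : GlobalRegion (divisorLogVolume F)) :
    degF F (globalRegionEquivADivisor F S - ADivisor.principal (f : F)) =
      degF F (globalRegionEquivADivisor F S) := by
  rw [← globalRegionEquivADivisor_principalAction, ← globalLogVolume_eq_degF, ← globalLogVolume_eq_degF,
    globalLogVolume_principalAction]

/-- **IUTchIII:Prop3.9(iii)** (kurims p.117) DEGREE CLAUSE in the arithmetic-divisor model: "the global
log-volume `μ^log_{A,𝕍_ℚ}(𝔍)` is equal to the degree of the arithmetic line bundle determined by `𝔍` …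
relative to a suitable normalization" — the statement file's `Prop39iii_degree` HOLDS with objects the
arithmetic divisors `𝔞 ∈ ADiv_ℝ(F)`, `regionOf 𝔞 := S_𝔞`, `deg := deg_F` and normalization constant
`c = 1`. [claim: Mochizuki2012, status: disputed] -/
theorem prop39iii_degree_divisorModel :
    Prop39iii_degree (divisorLogVolume F) (globalRegionEquivADivisor F).symm (degF F) :=
  ⟨1, one_pos, fun a => by rw [one_mul, globalLogVolume_symm_eq_degF]⟩

/-- "the degree of the arithmetic LINE BUNDLE determined by `𝔍`": the global log-volume of `S` only
depends on the class of `𝔞_S` in `ADiv_ℝ(F)/APrc(F)` (principal divisors act with log-volume `0`; [GenEll]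
§1 `ADiv(F)/APrc(F) ⥲ APic(Spec 𝒪_F)`) — it is the tree's descended degree `degFQuot` of that class.
[claim: Mochizuki2012, status: disputed] -/
theorem globalLogVolume_eq_degFQuot (S : GlobalRegion (divisorLogVolume F)) :
    globalLogVolume (divisorLogVolume F) S =
      degFQuot F (globalRegionEquivADivisor F S : ADivisor F ⧸ APrc F) := by
  rw [degFQuot_mk, globalLogVolume_eq_degF]

/-- Regions whose divisors differ by a principal divisor (i.e. determine the same arithmetic line bundle)
have the same global log-volume. [claim: Mochizuki2012, status: disputed] -/
theorem globalLogVolume_eq_of_sub_mem_APrc {S T : GlobalRegion (divisorLogVolume F)}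
    (h : globalRegionEquivADivisor F S - globalRegionEquivADivisor F T ∈ APrc F) :
    globalLogVolume (divisorLogVolume F) S = globalLogVolume (divisorLogVolume F) T := by
  rw [globalLogVolume_eq_degF, globalLogVolume_eq_degF]
  exact degF_eq_of_sub_mem_APrc h

/-- Effective divisors (all `c_v ≥ 0`, i.e. regions containing the unit regions) have nonnegative global
log-volume. [claim: Mochizuki2012, status: disputed] -/
theorem globalLogVolume_nonneg_of_isEffective {S : GlobalRegion (divisorLogVolume F)}
    (h : (globalRegionEquivADivisor F S).IsEffective) :
    0 ≤ globalLogVolume (divisorLogVolume F) S := by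
  rw [globalLogVolume_eq_degF]
  exact degF_nonneg F h

/-- NON-VACUITY of the action hypothesis: the action is not trivial — for `f ∈ F^×` not a unit at some
finite place (e.g. `ord_v(f) ≠ 0`), `f·S ≠ S`; so `prop39iii_invariance_divisorModel` is not an
invariance under a trivial action. [claim: Mochizuki2012, status: disputed] -/
theorem principalAction_ne_self {f : Fˣ} {v : Place F} (hv : ADivisor.principal (f : F) v ≠ 0)
    (S : GlobalRegion (divisorLogVolume F)) : principalAction F f S ≠ S := by
  intro h
  have := congrArg (fun T : GlobalRegion (divisorLogVolume F) => T.1 v) h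
  simp only [principalAction_apply, sub_eq_self] at this
  exact hv this

end Literature.IUT.LogThetaLattice
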